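import Literature.AlgebraicGeometry.HodgeTheory.SemiregularVariationalHodge
import Literature.AlgebraicGeometry.HodgeTheory.MotivatedClassesDeformationInputs
import Literature.AlgebraicGeometry.KTheory.PullbackVectorBundle
import HarnessLib

/-!
# Proved fragments of Perry 2026, Thm. 1.1 (2) / Buchweitz–Flenner 2003, Thm. 5.1 (the parts that need no deformation theory)

Family `hodge`, layer `Literature/AlgebraicGeometry/HodgeTheory`. Companion (`…Proofs`) of
`SemiregularVariationalHodge.lean`, which vendors the two NAMED FACTS
`BuchweitzFlenner2003_variationalHodge_semiregular` (BF Thm. 5.1, germ form, `I = {1, 2}`) and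
`Perry2026_semiregular_remainsAlgebraic` (Perry Thm. 1.1 (2), global form, `B₀ = 0`). Neither fact is
discharged here. The printed proofs (BF §5, p. 27: "`ℰ_0` lifts to all infinitesimal neighbourhoods
(Prop. 5.9, Lemma 5.10) […] Artin's approximation theorem […] the uniqueness of the horizontal lifting
gives `α_p = ch_p(ℱ)`"; Perry §4 Thm. 4.1 and §6 Thm. 6.1: smoothness of the moduli stack of gluable
objects at a semiregular point via Pridham's semiregularity theorem, then [IHC-CY2]) rest on the
deformation–obstruction theory of coherent sheaves / perfect complexes, the Hodge-theoretic vanishing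
`σ(ob) = 0` (Bloch, BF Thm. 4.2, Pridham), algebraization (versality + Artin approximation / moduli
stacks of objects) and the spreading of algebraicity of a flat section from an open set to the whole
base — none of which the tree or Mathlib has (the tree's `Deformation/…Obstruction` files are
hypothesis structures). What IS provable today, and is proved below sorry-free, is the
TOPOLOGICAL skeleton of both arguments on the tree's real carriers (`FiberClass`, `transportFun`,
Ehresmann's theorem in the proved form `isCohomologicallyLocallyTrivialOn_univ_of_isSmoothProjectiveFamily`,
SGA1 XII 2.4 in the proved form `Motives.ComplexPoints.connectedSpace_iff_holds`):

* `transportFun_apply_of_continuous` — **a continuous family of fibre classes is flat**: transport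
  along any path takes `w(s)` to `w(t)` ("the uniqueness of the horizontal lifting"; unique path
  lifting in the covering space `FiberClass π k|_U → U`).
* `eq_of_continuous_of_eq_at` — **identity principle**: two continuous families of fibre classes
  over a path-connected cohomologically locally trivial base that agree at one point agree
  everywhere.
* `Perry2026_conclusion_of_iso_pullback` — **Perry's conclusion (2) granted Perry's conclusion (1)
  globally**: if the sheaf `E₀` on `X_{s₀}` is the restriction of a finite locally free `𝓔` on the
  total space `𝒳` (no semiregularity needed), then every continuous family `w` of fibre classes with
  `w_k(s₀) = ch_k(E₀)` is algebraic on every fibre: `w_k(s) = ch_k(𝓔)|_{X_s} = ch_k(𝓔|_{X_s})`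
  (`S(ℂ)` is connected for `S` smooth and integral; functoriality and algebraicity of `ch`,
  `ChernCharacterBetti.map_ch` / `ch_mem_algebraicClasses`). This is exactly the step
  "`α_p(s) = ch_p(ℱ|X_s)` is algebraic" of BF p. 27 / "(1) ⇒ (2) on the image of `U`" of Perry
  Thm. 6.1, isolated from the existence of the deformation `ℱ`, which is the deep input.
* `BuchweitzFlenner2003_variationalHodge_semiregular.perry_near` — **the germ fact gives Perry's
  conclusion in degrees `1` and `2` on a neighbourhood of `s₀`**: under the hypotheses of
  `Perry2026_semiregular_remainsAlgebraic`, the BF fact (applied over `U = S(ℂ)`, cohomologically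
  locally trivial by Ehresmann; its Hodge-type hypothesis holds because the transports of
  `ch_k(E₀)` ARE the values `w_k(t)`, by flatness of `w`) yields an open `W ∋ s₀` — the path
  component of `s₀` in BF's `W`, `S(ℂ)` being a manifold — on which `w₁`, `w₂` are algebraic.
  What separates this from Perry's statement is recorded, not hidden: degrees `k ≥ 3` (the tree's
  BF rendering is `I = {1, 2}`) and the passage from a neighbourhood of `s₀` to all of `S(ℂ)`
  (Perry Thm. 6.1 (2), the [IHC-CY2] spreading argument).
* `Perry2026_conclusion_of_eq_restrict`, `map_fiberι_chVirtual_mem_algebraicClasses`,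
  `Perry2026_conclusion_of_eq_restrict_chVirtual` — **the last step of [IHC-CY2] Prop. 8.1**
  (= Perry Thm. 6.1 (2)): once a global object `F ∈ D_perf(𝒳)` of the right class exists, the flat
  section `w` agrees with the class of `F` everywhere and is therefore algebraic on every fibre; proved
  for an arbitrary global class with algebraic restrictions and for the Chern character `chVirtual`
  of a bounded complex of vector bundles presenting `F`.

## References

* [Perry2026Semiregularity] A. Perry, The semiregularity theorem for equivariant noncommutative
  varieties, arXiv:2604.00511 (2026), Thm. 1.1, Thm. 4.1 (proof), Thm. 6.1 (proof).
* [BuchweitzFlenner2003] R.-O. Buchweitz, H. Flenner, A semiregularity map for modules and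
  applications to deformations, Compositio Math. 137 (2003), §5 Thm. 5.1 and its proof (p. 27).
* [VoisinHodgeI2002] C. Voisin, Hodge Theory and Complex Algebraic Geometry I, Thm. 9.3, §9.2.1.
* [VoisinHodgeII2003] C. Voisin, Hodge Theory and Complex Algebraic Geometry II, §3.1.2.
* [Perry2022] A. Perry, The integral Hodge conjecture for two-dimensional Calabi–Yau categories,
  Compositio Math. 158 (2022) (arXiv:2004.03163), Prop. 8.1 and its proof (the reference [IHC-CY2]
  of Perry 2026, Thm. 6.1 (2)).
* [Fulton1998] W. Fulton, Intersection Theory, 2nd ed. (1998), §15.1 (ii), Prop. 19.1.2.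
-/

noncomputable section

open CategoryTheory AlgebraicGeometry
open _root_.Topology _root_.Filter
open Literature.AlgebraicTopology.SingularHomology

namespace Literature.AlgebraicGeometry.HodgeTheory

section HodgeTheory

variable {𝒳 S : Motives.SchemeOver ℂ} (π : 𝒳 ⟶ S) (k : ℕ) {U : Set (Motives.ComplexPoints S)}

/-! ### Continuous families of fibre classes are flat -/

/-- **A continuous family of fibre classes is flat** ("the uniqueness of the horizontal lifting"):
if `s ↦ (s, w(s))` is a continuous map into the espace étalé of `Rᵏ π_* ℂ`, then transport along
every homotopy class of paths `γ` from `s` to `t` inside a cohomologically locally trivial `U` takes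
`w(s)` to `w(t)` — `w ∘ γ` is the lift of `γ` starting at `(s, w(s))`, and lifts are unique.
[cite: VoisinHodgeI2002, §9.2.1] [cite: BuchweitzFlenner2003, §5 (proof of Thm. 5.1, p. 27)] -/
theorem transportFun_apply_of_continuous (hU : IsCohomologicallyLocallyTrivialOn π U)
    (w : ∀ s : Motives.ComplexPoints S, complexBetti (Motives.fiberOver π s) k)
    (hw : Continuous fun s => (⟨s, w s⟩ : FiberClass π k)) {s t : U}
    (γ : Path.Homotopic.Quotient s t) : transportFun π k hU γ (w s.1) = w t.1 := by
  induction γ using Quotient.ind with | _ γ =>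
  exact transportFun_eq_of_continuous π k hU γ (fun u ↦ w (γ u).1)
    (hw.comp (continuous_subtype_val.comp γ.continuous)) (by rw [γ.source]) (by rw [γ.target])

/-- **Identity principle for flat families**: over a path-connected base that is cohomologically
locally trivial throughout, two continuous families of fibre classes which agree at one point `s₀`
agree at every point (join `s₀` to `s` and transport: both values at `s` are the transport of the
common value at `s₀`). [cite: VoisinHodgeII2003, §3.1.2] [cite: VoisinHodgeI2002, §9.2.1] -/
theorem eq_of_continuous_of_eq_at [PathConnectedSpace (Motives.ComplexPoints S)]
    (hU : IsCohomologicallyLocallyTrivialOn π (Set.univ : Set (Motives.ComplexPoints S)))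
    (w w' : ∀ s : Motives.ComplexPoints S, complexBetti (Motives.fiberOver π s) k)
    (hw : Continuous fun s => (⟨s, w s⟩ : FiberClass π k))
    (hw' : Continuous fun s => (⟨s, w' s⟩ : FiberClass π k)) {s₀ : Motives.ComplexPoints S}
    (h₀ : w s₀ = w' s₀) (s : Motives.ComplexPoints S) : w s = w' s := by
  have hcont : Continuous fun x : Motives.ComplexPoints S =>
      (⟨x, Set.mem_univ x⟩ : (Set.univ : Set (Motives.ComplexPoints S))) :=
    continuous_id.subtype_mk _
  let γ : Path (⟨s₀, Set.mem_univ s₀⟩ : (Set.univ : Set (Motives.ComplexPoints S)))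
      ⟨s, Set.mem_univ s⟩ :=
    (PathConnectedSpace.somePath s₀ s).map hcont
  have h1 : transportFun π k hU ⟦γ⟧ (w s₀) = w s :=
    transportFun_apply_of_continuous π k hU w hw ⟦γ⟧
  have h2 : transportFun π k hU ⟦γ⟧ (w' s₀) = w' s :=
    transportFun_apply_of_continuous π k hU w' hw' ⟦γ⟧
  rw [← h1, ← h2, h₀]

variable {π k}

/-- Under the data of `Perry2026_semiregular_remainsAlgebraic` — continuous families `w_k` with
`w_k(s₀) = ch_k(E₀)` — the transports of `ch_k(E₀)` along paths from `s₀` ARE the values `w_k(t)`;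
this is how Perry's "lifts to a global section `w` of the local system" feeds the horizontal-section
hypothesis of Buchweitz–Flenner's Thm. 5.1. [cite: Perry2026Semiregularity, Thm. 1.1]
[cite: BuchweitzFlenner2003, §5 Thm. 5.1] -/
theorem transportFun_ch_eq_of_continuous (hU : IsCohomologicallyLocallyTrivialOn π U)
    (C : ChernCharacterBetti)
    (w : ∀ (k : ℕ) (s : Motives.ComplexPoints S), complexBetti (Motives.fiberOver π s) (2 * k))
    (hwc : ∀ k, Continuous fun s => (⟨s, w k s⟩ : FiberClass π (2 * k))) {s₀ : U}
    (E₀ : (Motives.fiberOver π s₀.1).left.Modules)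
    (hw₀ : ∀ k, w k s₀.1 = C.ch (Motives.fiberOver π s₀.1) E₀ k) (k : ℕ) {t : U}
    (γ : Path.Homotopic.Quotient s₀ t) :
    transportFun π (2 * k) hU γ (C.ch (Motives.fiberOver π s₀.1) E₀ k) = w k t.1 := by
  rw [← hw₀ k]
  exact transportFun_apply_of_continuous π (2 * k) hU (w k) (hwc k) γ

/-! ### Perry's conclusion (2) granted the deformation of `E₀` to the total space -/

/-- **Perry 2026, Thm. 1.1: conclusion (2) from a GLOBAL form of conclusion (1)** (the step
"`α_p(s) = ch_p(ℱ|X_s)` is algebraic" of BF's proof, p. 27). Let `π : 𝒳 ⟶ S` be a smooth projective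
family over a smooth, integral, quasi-projective `ℂ`-scheme `S`, `w_k` continuous families of fibre
classes, `s₀ ∈ S(ℂ)`, and suppose the sheaf `E₀` on `X_{s₀}` with `w_k(s₀) = ch_k(E₀)` is the
restriction `E₀ ≅ 𝓔|_{X_{s₀}}` of a finite locally free `𝓔` on `𝒳`. Then `w_k(s)` is an algebraic
class on `X_s` for every `s ∈ S(ℂ)` and every `k`: `S(ℂ)` is connected (`S` is irreducible; SGA1 XII
2.4, the tree's `connectedSpace_iff_holds`) and `R^{2k}π_*ℂ` is a local system on it (Ehresmann),
so the flat families `w_k` and `s ↦ ch_k(𝓔)|_{X_s}` agree everywhere, having the same value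
`ch_k(𝓔|_{X_{s₀}}) = ch_k(E₀)` at `s₀` (`map_ch`, `ch_congr`); and `ch_k(𝓔)|_{X_s} = ch_k(𝓔|_{X_s})`
is algebraic on the smooth projective `X_s` (`ch_mem_algebraicClasses`). No semiregularity is used:
it is the EXISTENCE of `𝓔` (Perry's (1), BF's `ℱ`) that semiregularity provides.
[cite: Perry2026Semiregularity, Thm. 1.1 and proof of Thm. 6.1]
[cite: BuchweitzFlenner2003, §5 (proof of Thm. 5.1, p. 27)] -/
theorem Perry2026_conclusion_of_iso_pullback (C : ChernCharacterBetti)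
    {𝒳 S : Motives.SchemeOver ℂ} (π : 𝒳 ⟶ S) (n : ℕ) (hπ : Motives.IsSmoothProjectiveFamily π n)
    (hS : IsQuasiProjectiveOver S) (hSi : IsIntegral S.left)
    (hSs : _root_.AlgebraicGeometry.Smooth S.hom)
    (w : ∀ (k : ℕ) (s : Motives.ComplexPoints S), complexBetti (Motives.fiberOver π s) (2 * k))
    (hwc : ∀ k, Continuous fun s => (⟨s, w k s⟩ : FiberClass π (2 * k)))
    (s₀ : Motives.ComplexPoints S) (E₀ : (Motives.fiberOver π s₀).left.Modules)
    (𝓔 : 𝒳.left.Modules) (h𝓔 : Motives.IsFiniteLocallyFree 𝓔)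
    (e : (Scheme.Modules.pullback (Motives.fiberι π s₀).left).obj 𝓔 ≅ E₀)
    (hw₀ : ∀ k, w k s₀ = C.ch (Motives.fiberOver π s₀) E₀ k)
    (s : Motives.ComplexPoints S) (k : ℕ) : w k s ∈ algebraicClasses (Motives.fiberOver π s) k := by
  haveI := hSi
  haveI := hSs
  haveI : LocallyOfFiniteType S.hom := hS.locallyOfFiniteType
  haveI : ConnectedSpace (Motives.ComplexPoints S) :=
    (Motives.ComplexPoints.connectedSpace_iff_holds S).2 inferInstance
  obtain ⟨d, hd⟩ := exists_smoothOfRelativeDimension_of_connectedSpace_complexPoints S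
  haveI := hd
  haveI := pathConnectedSpace_complexPoints_of_smoothOfRelativeDimension S d
  have hU : IsCohomologicallyLocallyTrivialOn π (Set.univ : Set (Motives.ComplexPoints S)) :=
    isCohomologicallyLocallyTrivialOn_univ_of_isSmoothProjectiveFamily π d hπ hS
  have key : w k s = complexBetti.map (Motives.fiberι π s) (2 * k) (C.ch 𝒳 𝓔 k) := by
    refine eq_of_continuous_of_eq_at π (2 * k) hU (w k)
      (fun s => complexBetti.map (Motives.fiberι π s) (2 * k) (C.ch 𝒳 𝓔 k)) (hwc k)
      (continuous_globalSection π (2 * k) (C.ch 𝒳 𝓔 k)) (s₀ := s₀) ?_ s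
    rw [hw₀ k, C.map_ch (Motives.fiberι π s₀) 𝓔 h𝓔.isVectorBundle k, C.ch_congr e k]
  rw [key, C.map_ch (Motives.fiberι π s) 𝓔 h𝓔.isVectorBundle k]
  exact C.ch_mem_algebraicClasses (hπ.isSmoothProjective s) _
    (h𝓔.pullback (Motives.fiberι π s).left).isVectorBundle k

/-! ### From the germ fact to Perry's conclusion near the base point, degrees `1` and `2` -/

/-- **Buchweitz–Flenner's Thm. 5.1 (germ fact, `I = {1, 2}`) gives Perry's conclusion (2) in
degrees `1` and `2` on a neighbourhood of `s₀`.** Under the hypotheses of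
`Perry2026_semiregular_remainsAlgebraic` (smooth projective `π : 𝒳 ⟶ S` over a smooth integral
quasi-projective `S`; continuous families `w_k` of rational `(k,k)` fibre classes; `E₀` finite
locally free and `{0,1}`-semiregular on `X_{s₀}` with `w_k(s₀) = ch_k(E₀)`), there is an open
`W ∋ s₀` in `S(ℂ)` with `w₁(t)`, `w₂(t)` algebraic on `X_t` for all `t ∈ W`. Proof: `R^kπ_*ℂ` is a
local system on all of `S(ℂ)` (Ehresmann, proved), the transports of `ch_k(E₀)` are the `w_k(t)`
(`transportFun_ch_eq_of_continuous`), hence of type `(k,k)`; the fact gives an open `W₀ ∋ s₀` on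
which transports along paths inside `W₀` are algebraic; take `W` the path component of `s₀` in
`W₀` (open: `S(ℂ)` is a topological manifold). Not obtained this way: degrees `k ≥ 3` and points
outside a neighbourhood of `s₀` (Perry Thm. 6.1 (2)). [cite: BuchweitzFlenner2003, §5 Thm. 5.1]
[cite: Perry2026Semiregularity, Thm. 1.1 (2)] -/
theorem BuchweitzFlenner2003_variationalHodge_semiregular.perry_near
    (hBF : BuchweitzFlenner2003_variationalHodge_semiregular) (C : ChernCharacterBetti)
    {𝒳 S : Motives.SchemeOver ℂ} (π : 𝒳 ⟶ S) (n : ℕ) (hπ : Motives.IsSmoothProjectiveFamily π n)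
    (hS : IsQuasiProjectiveOver S) (hSi : IsIntegral S.left)
    (hSs : _root_.AlgebraicGeometry.Smooth S.hom)
    (w : ∀ (k : ℕ) (s : Motives.ComplexPoints S), complexBetti (Motives.fiberOver π s) (2 * k))
    (hwc : ∀ k, Continuous fun s => (⟨s, w k s⟩ : FiberClass π (2 * k)))
    (hwH : ∀ k s, (⟨s, w k s⟩ : FiberClass π (2 * k)) ∈ locusOfHodgeClasses π n k)
    (s₀ : Motives.ComplexPoints S) (E₀ : (Motives.fiberOver π s₀).left.Modules)
    (hE₀ : Motives.IsFiniteLocallyFree E₀) (hsr : IsZeroOneSemiregular hE₀)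
    (hw₀ : ∀ k, w k s₀ = C.ch (Motives.fiberOver π s₀) E₀ k) :
    ∃ W : Set (Motives.ComplexPoints S), IsOpen W ∧ s₀ ∈ W ∧
      ∀ t ∈ W, w 1 t ∈ algebraicClasses (Motives.fiberOver π t) 1 ∧
        w 2 t ∈ algebraicClasses (Motives.fiberOver π t) 2 := by
  haveI := hSi
  haveI := hSs
  haveI : LocallyOfFiniteType S.hom := hS.locallyOfFiniteType
  haveI : ConnectedSpace (Motives.ComplexPoints S) :=
    (Motives.ComplexPoints.connectedSpace_iff_holds S).2 inferInstance
  obtain ⟨d, hd⟩ := exists_smoothOfRelativeDimension_of_connectedSpace_complexPoints S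
  haveI := hd
  have hU : IsCohomologicallyLocallyTrivialOn π (Set.univ : Set (Motives.ComplexPoints S)) :=
    isCohomologicallyLocallyTrivialOn_univ_of_isSmoothProjectiveFamily π d hπ hS
  -- Perry's data give Buchweitz–Flenner's hypotheses over `U = S(ℂ)`
  let s₀' : (Set.univ : Set (Motives.ComplexPoints S)) := ⟨s₀, Set.mem_univ s₀⟩
  have hHodge : ∀ (t : (Set.univ : Set (Motives.ComplexPoints S)))
      (γ : Path.Homotopic.Quotient s₀' t),
      IsOfHodgeType n (Motives.fiberOver π t.1) (2 * 1) 1 1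
          (transportFun π (2 * 1) hU γ (C.ch (Motives.fiberOver π s₀'.1) E₀ 1)) ∧
        IsOfHodgeType n (Motives.fiberOver π t.1) (2 * 2) 2 2
          (transportFun π (2 * 2) hU γ (C.ch (Motives.fiberOver π s₀'.1) E₀ 2)) := by
    intro t γ
    refine ⟨?_, ?_⟩
    · rw [transportFun_ch_eq_of_continuous hU C w hwc (s₀ := s₀') E₀ hw₀ 1 γ]
      exact ((mem_locusOfHodgeClasses_iff _).1 (hwH 1 t.1)).2
    · rw [transportFun_ch_eq_of_continuous hU C w hwc (s₀ := s₀') E₀ hw₀ 2 γ]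
      exact ((mem_locusOfHodgeClasses_iff _).1 (hwH 2 t.1)).2
  obtain ⟨W, hWo, hW₀, hWU, hW⟩ := hBF C π n hπ hSs hU s₀' E₀ hE₀ hsr hHodge
  -- shrink `W` to the path component of `s₀`: `S(ℂ)` is a `2d`-manifold, locally path connected
  letI := Motives.ComplexPoints.chartedSpace S d
  haveI : LocallyPathConnectedSpace (Motives.ComplexPoints S) :=
    ChartedSpace.locallyPathConnectedSpace (EuclideanSpace ℝ (Fin (2 * d))) (Motives.ComplexPoints S)
  refine ⟨pathComponentIn W s₀, hWo.pathComponentIn s₀, mem_pathComponentIn_self hW₀,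
    fun t ht ↦ ?_⟩
  have hj : JoinedIn W s₀ t := ht
  have hp : ∀ u, hj.somePath u ∈ W := hj.somePath_mem
  let γ : Path (⟨s₀, hW₀⟩ : W) ⟨t, pathComponentIn_subset ht⟩ :=
    { toFun := fun u ↦ ⟨hj.somePath u, hp u⟩
      continuous_toFun := hj.somePath.continuous.subtype_mk _
      source' := Subtype.ext hj.somePath.source
      target' := Subtype.ext hj.somePath.target }
  have hW' := hW ⟨t, pathComponentIn_subset ht⟩ ⟦γ⟧
  have h1 : transportFun π (2 * 1) (hU.mono hWU hWo) ⟦γ⟧ (C.ch (Motives.fiberOver π s₀) E₀ 1) =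
      w 1 t :=
    transportFun_ch_eq_of_continuous (hU.mono hWU hWo) C w hwc (s₀ := (⟨s₀, hW₀⟩ : W)) E₀ hw₀ 1 ⟦γ⟧
  have h2 : transportFun π (2 * 2) (hU.mono hWU hWo) ⟦γ⟧ (C.ch (Motives.fiberOver π s₀) E₀ 2) =
      w 2 t :=
    transportFun_ch_eq_of_continuous (hU.mono hWU hWo) C w hwc (s₀ := (⟨s₀, hW₀⟩ : W)) E₀ hw₀ 2 ⟦γ⟧
  rw [h1, h2] at hW'
  exact hW'

/-- The degree-`2` instance in the shape consumed through `Perry2026_semiregular_remainsAlgebraic.two`,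
NEAR the base point, from the Buchweitz–Flenner germ fact alone: `w₂(t)` is algebraic on `X_t` for
all `t` in a neighbourhood of `s₀`. [cite: BuchweitzFlenner2003, §5 Thm. 5.1] -/
theorem BuchweitzFlenner2003_variationalHodge_semiregular.perry_near_two
    (hBF : BuchweitzFlenner2003_variationalHodge_semiregular) (C : ChernCharacterBetti)
    {𝒳 S : Motives.SchemeOver ℂ} (π : 𝒳 ⟶ S) (n : ℕ) (hπ : Motives.IsSmoothProjectiveFamily π n)
    (hS : IsQuasiProjectiveOver S) (hSi : IsIntegral S.left)
    (hSs : _root_.AlgebraicGeometry.Smooth S.hom)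
    (w : ∀ (k : ℕ) (s : Motives.ComplexPoints S), complexBetti (Motives.fiberOver π s) (2 * k))
    (hwc : ∀ k, Continuous fun s => (⟨s, w k s⟩ : FiberClass π (2 * k)))
    (hwH : ∀ k s, (⟨s, w k s⟩ : FiberClass π (2 * k)) ∈ locusOfHodgeClasses π n k)
    (s₀ : Motives.ComplexPoints S) (E₀ : (Motives.fiberOver π s₀).left.Modules)
    (hE₀ : Motives.IsFiniteLocallyFree E₀) (hsr : IsZeroOneSemiregular hE₀)
    (hw₀ : ∀ k, w k s₀ = C.ch (Motives.fiberOver π s₀) E₀ k) :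
    ∀ᶠ t in 𝓝 s₀, w 2 t ∈ algebraicClasses (Motives.fiberOver π t) 2 := by
  obtain ⟨W, hWo, hW₀, hW⟩ :=
    hBF.perry_near C π n hπ hS hSi hSs w hwc hwH s₀ E₀ hE₀ hsr hw₀
  exact Filter.eventually_of_mem (hWo.mem_nhds hW₀) fun t ht ↦ (hW t ht).2

/-! ### The last step of Perry's proof: a global object of the right class makes every fibre value algebraic

Perry, Thm. 6.1 (2) is "[IHC-CY2]", i.e. A. Perry, *The integral Hodge conjecture for two-dimensional
Calabi–Yau categories*, Compositio Math. 158 (2022) = arXiv:2004.03163, Prop. 8.1, whose proof ends: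
"the object `E_U ∈ 𝒞_U ⊂ D_perf(X_U)` lifts to an object `F ∈ D_perf(X)` […] The class `φ_E` of `E`
must equal `φ`, since these sections of the local system agree over the open subset `U`. Therefore,
`φ_s` equals the class of `E_s` for every `s ∈ S(ℂ)`, and in particular is algebraic." On the tree's
carriers this last step is unconditional and is proved here in three shapes: for an arbitrary global
class with algebraic restrictions, for the Chern character of a vector bundle on `𝒳`
(`Perry2026_conclusion_of_iso_pullback` above), and for the Chern character `chVirtual` of a bounded
complex of vector bundles on `𝒳` (a global locally free presentation of the perfect complex `F`).
The inputs it does NOT cover — smoothness of the moduli stack at the semiregular point (Perry Thm. 4.1,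
Pridham), the étale section and the base change `S' → S`, and the extension of `E_U` to `𝒳`
([polishchuk] / Thomason–Trobaugh) — are the deformation-theoretic content of the named fact. -/

variable (π k) in
/-- **Identity principle against a global class**: a continuous family of fibre classes over
`S(ℂ)` (path connected, `R^kπ_*ℂ` a local system on it) which at one point `s₀` is the restriction
`A|_{X_{s₀}}` of a global class `A ∈ Hᵏ(𝒳(ℂ); ℂ)` is `s ↦ A|_{X_s}` everywhere ("these sections of
the local system agree"). [cite: VoisinHodgeII2003, §3.1.2] -/
theorem eq_map_fiberι_of_continuous_of_eq_at [PathConnectedSpace (Motives.ComplexPoints S)]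
    (hU : IsCohomologicallyLocallyTrivialOn π (Set.univ : Set (Motives.ComplexPoints S)))
    (w : ∀ s : Motives.ComplexPoints S, complexBetti (Motives.fiberOver π s) k)
    (hw : Continuous fun s => (⟨s, w s⟩ : FiberClass π k)) (A : complexBetti 𝒳 k)
    {s₀ : Motives.ComplexPoints S} (h₀ : w s₀ = complexBetti.map (Motives.fiberι π s₀) k A)
    (s : Motives.ComplexPoints S) : w s = complexBetti.map (Motives.fiberι π s) k A :=
  eq_of_continuous_of_eq_at π k hU w (fun s => complexBetti.map (Motives.fiberι π s) k A) hw
    (continuous_globalSection π k A) h₀ s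

/-- **Perry's conclusion (2) from global classes with algebraic restrictions.** For a smooth
projective family `π : 𝒳 ⟶ S` over a smooth integral quasi-projective `S` and continuous families
`w_k` of fibre classes: if `w_k(s₀) = A_k|_{X_{s₀}}` for global classes `A_k ∈ H^{2k}(𝒳(ℂ); ℂ)` all of
whose fibre restrictions `A_k|_{X_s}` are algebraic, then `w_k(s)` is algebraic on `X_s` for every
`s ∈ S(ℂ)` and every `k` (`S(ℂ)` is connected — SGA1 XII 2.4 — and `w_k = (s ↦ A_k|_{X_s})` by the
identity principle). [cite: Perry2026Semiregularity, Thm. 6.1 (2)] [cite: Perry2022, Prop. 8.1 (proof, last step)] -/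
theorem Perry2026_conclusion_of_eq_restrict
    {𝒳 S : Motives.SchemeOver ℂ} (π : 𝒳 ⟶ S) (n : ℕ) (hπ : Motives.IsSmoothProjectiveFamily π n)
    (hS : IsQuasiProjectiveOver S) (hSi : IsIntegral S.left)
    (hSs : _root_.AlgebraicGeometry.Smooth S.hom)
    (w : ∀ (k : ℕ) (s : Motives.ComplexPoints S), complexBetti (Motives.fiberOver π s) (2 * k))
    (hwc : ∀ k, Continuous fun s => (⟨s, w k s⟩ : FiberClass π (2 * k)))
    (s₀ : Motives.ComplexPoints S) (A : ∀ k : ℕ, complexBetti 𝒳 (2 * k))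
    (hA : ∀ (k : ℕ) (s : Motives.ComplexPoints S),
      complexBetti.map (Motives.fiberι π s) (2 * k) (A k) ∈ algebraicClasses (Motives.fiberOver π s) k)
    (hw₀ : ∀ k, w k s₀ = complexBetti.map (Motives.fiberι π s₀) (2 * k) (A k))
    (s : Motives.ComplexPoints S) (k : ℕ) : w k s ∈ algebraicClasses (Motives.fiberOver π s) k := by
  haveI := hSi
  haveI := hSs
  haveI : LocallyOfFiniteType S.hom := hS.locallyOfFiniteType
  haveI : ConnectedSpace (Motives.ComplexPoints S) :=
    (Motives.ComplexPoints.connectedSpace_iff_holds S).2 inferInstance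
  obtain ⟨d, hd⟩ := exists_smoothOfRelativeDimension_of_connectedSpace_complexPoints S
  haveI := hd
  haveI := pathConnectedSpace_complexPoints_of_smoothOfRelativeDimension S d
  have hU : IsCohomologicallyLocallyTrivialOn π (Set.univ : Set (Motives.ComplexPoints S)) :=
    isCohomologicallyLocallyTrivialOn_univ_of_isSmoothProjectiveFamily π d hπ hS
  rw [eq_map_fiberι_of_continuous_of_eq_at π (2 * k) hU (w k) (hwc k) (A k) (hw₀ k) s]
  exact hA k s

/-- **Restriction to a fibre of the Chern character of a bounded complex of vector bundles is
algebraic**: for a formal `ℤ`-combination `v` of finite locally free `𝒪_𝒳`-modules (a global locally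
free presentation `Σ (-1)ⁱ [Fⁱ]` of a perfect complex on `𝒳`) and `s ∈ S(ℂ)`,
`chVirtual(v)|_{X_s} = Σ m_E ch_k(E|_{X_s})` is an algebraic class on the smooth projective fibre `X_s`
(functoriality `map_ch`, pull-backs of vector bundles are vector bundles, `ch_mem_algebraicClasses`).
[cite: Fulton1998, §15.1 (ii) and Prop. 19.1.2] -/
theorem map_fiberι_chVirtual_mem_algebraicClasses (C : ChernCharacterBetti)
    {𝒳 S : Motives.SchemeOver ℂ} (π : 𝒳 ⟶ S) (n : ℕ) (hπ : Motives.IsSmoothProjectiveFamily π n)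
    (v : 𝒳.left.Modules →₀ ℤ) (hv : ∀ E ∈ v.support, Motives.IsFiniteLocallyFree E)
    (s : Motives.ComplexPoints S) (k : ℕ) :
    complexBetti.map (Motives.fiberι π s) (2 * k) (C.chVirtual 𝒳 k v) ∈
      algebraicClasses (Motives.fiberOver π s) k := by
  rw [C.chVirtual_apply, map_finsuppSum]
  refine Submodule.finsuppSum_mem (f := v) _ _ _ fun E hE ↦ ?_
  have hE' : Motives.IsFiniteLocallyFree E := hv E (Finsupp.mem_support_iff.2 hE)
  rw [map_zsmul, C.map_ch (Motives.fiberι π s) E hE'.isVectorBundle k]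
  exact zsmul_mem (C.ch_mem_algebraicClasses (hπ.isSmoothProjective s) _
    (hE'.pullback (Motives.fiberι π s).left).isVectorBundle k) _

/-- **Perry's conclusion (2) granted a global perfect complex of the right class** (the last step of
[IHC-CY2] Prop. 8.1 verbatim: "`E_U` lifts to an object `F ∈ D_perf(X)` […] `φ_s` equals the class of
`E_s` for every `s ∈ S(ℂ)`, and in particular is algebraic"): if `w_k(s₀) = ch_k(v)|_{X_{s₀}}` for the
Chern character `chVirtual` of a formal `ℤ`-combination `v` of finite locally free modules on `𝒳` (a
locally free presentation of `F`), then `w_k(s)` is algebraic on every fibre. No semiregularity enters;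
what semiregularity, Pridham's theorem, the étale section and the extension of perfect complexes
provide is the EXISTENCE of `F`. [cite: Perry2026Semiregularity, Thm. 6.1 (2)]
[cite: Perry2022, Prop. 8.1 (proof)] -/
theorem Perry2026_conclusion_of_eq_restrict_chVirtual (C : ChernCharacterBetti)
    {𝒳 S : Motives.SchemeOver ℂ} (π : 𝒳 ⟶ S) (n : ℕ) (hπ : Motives.IsSmoothProjectiveFamily π n)
    (hS : IsQuasiProjectiveOver S) (hSi : IsIntegral S.left)
    (hSs : _root_.AlgebraicGeometry.Smooth S.hom)
    (w : ∀ (k : ℕ) (s : Motives.ComplexPoints S), complexBetti (Motives.fiberOver π s) (2 * k))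
    (hwc : ∀ k, Continuous fun s => (⟨s, w k s⟩ : FiberClass π (2 * k)))
    (s₀ : Motives.ComplexPoints S) (v : 𝒳.left.Modules →₀ ℤ)
    (hv : ∀ E ∈ v.support, Motives.IsFiniteLocallyFree E)
    (hw₀ : ∀ k, w k s₀ = complexBetti.map (Motives.fiberι π s₀) (2 * k) (C.chVirtual 𝒳 k v))
    (s : Motives.ComplexPoints S) (k : ℕ) : w k s ∈ algebraicClasses (Motives.fiberOver π s) k :=
  Perry2026_conclusion_of_eq_restrict π n hπ hS hSi hSs w hwc s₀ (fun k ↦ C.chVirtual 𝒳 k v)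
    (fun k s ↦ map_fiberι_chVirtual_mem_algebraicClasses C π n hπ v hv s k) hw₀ s k

end HodgeTheory

end Literature.AlgebraicGeometry.HodgeTheory

end
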